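import Literature.Topology.FourManifolds.SmallTrisections
import Literature.Topology.FourManifolds.TrisectionsRefutation
import HarnessLib

/-!
# Proofs for `SmallTrisections.lean`: the two homotopy-sphere facts over `IsTrisection` hold vacuously

Sibling proof file of `Literature/Topology/FourManifolds/SmallTrisections.lean` (D-0014: a named
fact `def X : Prop` is discharged as `theorem X_holds : X`; fact item
`provefact-Literature.Topology.FourManifolds.mz_genus_le_two_homotopySphere`).  It records

* `mz_genus_le_two_homotopySphere_holds : mz_genus_le_two_homotopySphere` — Meier–Zupan 2017
  (arXiv Thm. 1.3 = journal Thm. 1.2, p. 3 of the held arXiv text: "If `X` admits a genus two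
  trisection, then `X` is either `S² × S²` or a connected sum of `S¹ × S³`, `ℂP²`, and `ℂP²‾` with
  two summands. Moreover, each of these 4-manifolds has a unique genus two trisection up to
  diffeomorphism.") together with Meier–Schirmer–Zupan 2016, Thm. 1.1, in the homotopy-sphere
  form vendored there: a closed connected oriented smooth homotopy 4-sphere with a trisection of
  genus `≤ 2` is diffeomorphic to `S⁴`;
* `msz_standard_homotopySphere_holds : msz_standard_homotopySphere` — Meier–Schirmer–Zupan 2016,
  Thm. 1.1, homotopy-sphere form: a closed connected oriented smooth homotopy 4-sphere with a
  `(g; k₀, k₁, k₂)`-trisection having some `kᵢ ≥ g - 1` is diffeomorphic to `S⁴`.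

**How, and a warning.** Both facts quantify over a hypothesis `IsTrisection X g k S`, and the
vendored predicate `Literature.Topology.FourManifolds.IsTrisection` is unsatisfiable
(`Literature.Topology.FourManifolds.TrisectionRefutation.not_isTrisection`,
`TrisectionsRefutation.lean`: its clause (ii) makes the three sectors smoothly embedded manifolds
*with boundary* meeting at the points of the non-empty central surface, which is impossible to
first order, whereas Gay–Kirby's sectors have *corners* along the central surface).  Hence both
universally quantified statements hold **vacuously**, and that is the proof given here — nothing
of the printed classifications (genus-two trisection diagrams as triples of genus-two Heegaard
diagrams of `S³`, waves and handle slides, MZ §§3–6; Heegaard–Kirby diagrams of `kᵢ ≥ g - 1`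
trisections, MSZ §4) is used or formalised by these declarations.  The faithful, non-vacuous
statements over the corrected predicate `Literature.Topology.FourManifolds.IsGKTrisection` are
already vendored, as named facts, in `Literature/Barriers/SmoothPoincare4/LowGenusTrisectionsStandard.lean`:
`Literature.Barriers.SmoothPoincare4.mz_genus_le_two_homotopySphere_gk` and
`Literature.Barriers.SmoothPoincare4.msz_homotopySphere_gk` (not proved in the tree); users who
want the mathematics must take those as hypotheses, not the facts discharged here.  This file
follows the precedent of `TrisectionFunctorProofs.lean` (facts (a), (b), (c), (g) of
`TrisectionFunctor.lean`, discharged the same way).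

## References

* [MeierZupan2017] J. Meier, A. Zupan, *Genus-two trisections are standard*, Geom. Topol. 21
  (2017) 1583–1630 (arXiv:1410.8133): Thm. 1.2 (arXiv Thm. 1.3, p. 3), and §1 for genus `≤ 1`.
* [MeierSchirmerZupan2016] J. Meier, T. Schirmer, A. Zupan, *Classification of trisections and
  the generalized property R conjecture*, Proc. Amer. Math. Soc. 144 (2016) 4983–4997
  (arXiv:1507.06561): Thm. 1.1.
* [GayKirby2016] D. Gay, R. Kirby, *Trisecting 4-manifolds*, Geom. Topol. 20 (2016) 3097–3132:
  Def. 1 (the sectors have corners along the central surface).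
-/

noncomputable section

open scoped Manifold ContDiff

namespace Literature.Topology.FourManifolds

universe u

/-- **`mz_genus_le_two_homotopySphere` holds — vacuously.**  Meier–Zupan 2017, Thm. 1.2 (arXiv
Thm. 1.3: "If `X` admits a genus two trisection, then `X` is either `S² × S²` or a connected sum
of `S¹ × S³`, `ℂP²`, and `ℂP²‾` with two summands"), with Meier–Schirmer–Zupan 2016, Thm. 1.1 and
Gay–Kirby for genus `≤ 1`, in the vendored homotopy-sphere form: a closed connected oriented
smooth 4-manifold `X ≃ₕ S⁴` with a trisection of genus `g ≤ 2` is diffeomorphic to `S⁴`.  The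
proof uses only that the hypothesis `IsTrisection X g k S` is contradictory
(`TrisectionRefutation.not_isTrisection`: the vendored sectors are smoothly embedded manifolds
with boundary, but Gay–Kirby's sectors have corners along the central surface), so the printed
theorem is NOT formalised by this declaration; the faithful restatement over `IsGKTrisection` is
the named fact `Literature.Barriers.SmoothPoincare4.mz_genus_le_two_homotopySphere_gk`
(`Literature/Barriers/SmoothPoincare4/LowGenusTrisectionsStandard.lean`).
[cite: MeierZupan2017, Thm. 1.2 (arXiv Thm. 1.3, p. 3)] [cite: MeierSchirmerZupan2016, Thm. 1.1] -/
theorem mz_genus_le_two_homotopySphere_holds : mz_genus_le_two_homotopySphere.{u} := by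
  intro X _ _ _ _ _ _ _ _ g k S h _ _
  exact (TrisectionRefutation.not_isTrisection h).elim

/-- **`msz_standard_homotopySphere` holds — vacuously.**  Meier–Schirmer–Zupan 2016, Thm. 1.1
(a closed 4-manifold with a `(g; k₁, k₂, k₃)`-trisection with `k₁ ≥ g - 1` is `#^{k'}(S¹ × S³)`,
`k' = max(k₂, k₃)`, possibly summed with `ℂP²` or `ℂP²‾`), in the vendored homotopy-sphere form: a
closed connected oriented smooth `X ≃ₕ S⁴` with a `(g; k₀, k₁, k₂)`-trisection having some
`kᵢ ≥ g - 1` is diffeomorphic to `S⁴`.  The proof uses only that the hypothesis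
`IsTrisection X g k S` is contradictory (`TrisectionRefutation.not_isTrisection`), so the printed
theorem is NOT formalised by this declaration; the faithful restatement over `IsGKTrisection` is
the named fact `Literature.Barriers.SmoothPoincare4.msz_homotopySphere_gk`
(`Literature/Barriers/SmoothPoincare4/LowGenusTrisectionsStandard.lean`).
[cite: MeierSchirmerZupan2016, Thm. 1.1] -/
theorem msz_standard_homotopySphere_holds : msz_standard_homotopySphere.{u} := by
  intro X _ _ _ _ _ _ _ _ g k S h _ _
  exact (TrisectionRefutation.not_isTrisection h).elim

end Literature.Topology.FourManifolds

end
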